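import Literature.AlgebraicGeometry.HodgeTheory.AbelianVarietyEndomorphismsHOne
import Literature.AlgebraicGeometry.HodgeTheory.AbelianVarietyHOneExactness

/-!
# Crux `HodgeAbelianVarieties` (stmt-HodgeConjecture-1333), line `cm-pivot-andre` — helper W5
`bijective_sum_complexBetti_map_of_biproduct`

André's construction (towards the registered stub `stub_andreSplitWeilCM`) presents a power
`B = Aⁿ` of a complex abelian variety as a finite biproduct in the preadditive category
`AbelianVariety ℂ`: projections `π i : B ⟶ A` and injections `ι i : A ⟶ B` with
`ι i ≫ π j = δ_{ij}` and `∑ i, π i ≫ ι i = 𝟙 B`. This file identifies `H¹(B(ℂ); ℂ)` with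
`Fin n → H¹(A(ℂ); ℂ)`: the map `Φ(c) := ∑ i, (π i)^* (c i)` is bijective and
`(ι j)^* (Φ c) = c j`. The proof is purely formal from the additivity `(f + g)^* = f^* + g^*` of
pull-back on `H¹` (`complexBetti_map_add_one`, Lange–Birkenhake §1.1: the analytic representation
`ρ_r : Hom(X, X') → Hom_ℤ(Λ, Λ')` is a homomorphism, `H¹ = Hom(Λ, –)`) and contravariant
functoriality `(f ≫ g)^* = g^* ≫ f^*` (`complexBetti_map_comp_hom`):
`(ι j)^* ∘ (π i)^* = (ι j ≫ π i)^* = δ_{ji}` gives the second statement and injectivity, and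
`x = (𝟙 B)^* x = (∑ i, π i ≫ ι i)^* x = ∑ i, (π i)^* ((ι i)^* x)` gives surjectivity.
-/

set_option linter.dupNamespace false

noncomputable section

namespace Summit.HodgeConjecture.HodgeConjecture.Theorems.HodgeAbelianVarieties.CMPivotAndre

open CategoryTheory
open Literature.AlgebraicGeometry Literature.AlgebraicGeometry.Motives Literature.AlgebraicGeometry.HodgeTheory

variable {A B C : AbelianVariety ℂ}

/-- **Sum additivity on `H¹`**: `(∑ i ∈ s, f i)^* = ∑ i ∈ s, (f i)^*` as maps
`H¹(B(ℂ); ℂ) ⟶ H¹(A(ℂ); ℂ)` (Lange–Birkenhake: the analytic/rational representation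
`Hom(A, B) → Hom(H¹(B), H¹(A))` is a homomorphism of abelian groups), by induction on `s` from
`(f + g)^* = f^* + g^*` (`complexBetti_map_add_one`) and `0^* = 0` (`complexBetti_map_zero_one`).
[cite: LangeBirkenhake1992, §1.1 (p. 19)] -/
theorem complexBetti_map_finsetSum_one {J : Type*} (s : Finset J) (f : J → (A ⟶ B)) :
    complexBetti.map (∑ i ∈ s, f i).hom.hom.hom 1 = ∑ i ∈ s, complexBetti.map (f i).hom.hom.hom 1 := by
  classical
  induction s using Finset.induction_on with
  | empty => rw [Finset.sum_empty, Finset.sum_empty, complexBetti_map_zero_one]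
  | insert a s ha ih =>
    rw [Finset.sum_insert ha, Finset.sum_insert ha, complexBetti_map_add_one, ih]

/-- `f^* (g^* x) = (f ≫ g)^* x` on `H¹` (contravariant functoriality, applied to a class). [folklore] -/
theorem complexBetti_map_map_one_apply (f : A ⟶ B) (g : B ⟶ C) (x : complexBetti C.X 1) :
    complexBetti.map f.hom.hom.hom 1 (complexBetti.map g.hom.hom.hom 1 x) =
      complexBetti.map (f ≫ g).hom.hom.hom 1 x := by
  rw [complexBetti_map_comp_hom, CategoryTheory.comp_apply]

/-- `(𝟙 A)^* x = x` on `H¹`. [folklore] -/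
theorem complexBetti_map_id_one_apply (x : complexBetti A.X 1) :
    complexBetti.map (𝟙 A : A ⟶ A).hom.hom.hom 1 x = x := by
  change complexBetti.map (𝟙 A.X) 1 x = x
  rw [complexBetti.map_id, CategoryTheory.id_apply]

/-- `0^* x = 0` on `H¹`. [cite: LangeBirkenhake1992, §1.1 (p. 19)] -/
theorem complexBetti_map_zero_one_apply (x : complexBetti B.X 1) :
    complexBetti.map (0 : A ⟶ B).hom.hom.hom 1 x = 0 := by
  rw [complexBetti_map_zero_one]
  rfl

/-- **Biproduct identities on `H¹`**: if `ι i ≫ π j = δ_{ij}` then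
`(ι j)^* ((π i)^* x) = δ_{ji} x`. [folklore] -/
theorem complexBetti_map_inj_proj_one_apply {n : ℕ} (π : Fin n → (B ⟶ A)) (ι : Fin n → (A ⟶ B))
    (hιπ : ∀ i j : Fin n, ι i ≫ π j = if i = j then 𝟙 A else 0) (i j : Fin n)
    (x : complexBetti A.X 1) :
    complexBetti.map (ι j).hom.hom.hom 1 (complexBetti.map (π i).hom.hom.hom 1 x) =
      if j = i then x else 0 := by
  rw [complexBetti_map_map_one_apply, hιπ j i]
  split_ifs with h
  · exact complexBetti_map_id_one_apply x
  · exact complexBetti_map_zero_one_apply x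

/-- **`H¹` of a finite biproduct of abelian varieties** (helper W5 of line `cm-pivot-andre`): for a
biproduct presentation `π i : B ⟶ A`, `ι i : A ⟶ B` (`ι i ≫ π j = δ_{ij}`, `∑ i, π i ≫ ι i = 𝟙 B`)
in the preadditive category of complex abelian varieties, `Φ(c) = ∑ i, (π i)^* (c i)` is a bijection
`(Fin n → H¹(A(ℂ); ℂ)) → H¹(B(ℂ); ℂ)` with `(ι j)^* (Φ c) = c j` (Künneth in degree one for `Aⁿ`,
obtained formally from the additivity of `f ↦ f^*` on `H¹`).
[cite: LangeBirkenhake1992, §1.1 (p. 19)] -/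
theorem bijective_sum_complexBetti_map_of_biproduct : ∀ {n : ℕ} (A B : Literature.AlgebraicGeometry.Motives.AbelianVariety ℂ) (π : Fin n → (B ⟶ A)) (ι : Fin n → (A ⟶ B)), (∀ i j : Fin n, ι i ≫ π j = if i = j then 𝟙 A else 0) → (∑ i, π i ≫ ι i = 𝟙 B) → Function.Bijective (fun c : Fin n → Literature.AlgebraicGeometry.HodgeTheory.complexBetti A.X 1 => ∑ i, Literature.AlgebraicGeometry.HodgeTheory.complexBetti.map (π i).hom.hom.hom 1 (c i)) ∧ ∀ (c : Fin n → Literature.AlgebraicGeometry.HodgeTheory.complexBetti A.X 1) (j : Fin n), Literature.AlgebraicGeometry.HodgeTheory.complexBetti.map (ι j).hom.hom.hom 1 (∑ i, Literature.AlgebraicGeometry.HodgeTheory.complexBetti.map (π i).hom.hom.hom 1 (c i)) = c j := by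
  intro n A B π ι hιπ hsum
  have proj : ∀ (c : Fin n → complexBetti A.X 1) (j : Fin n),
      complexBetti.map (ι j).hom.hom.hom 1 (∑ i, complexBetti.map (π i).hom.hom.hom 1 (c i)) = c j := by
    intro c j
    rw [map_sum]
    simp_rw [complexBetti_map_inj_proj_one_apply π ι hιπ]
    rw [Finset.sum_ite_eq]
    simp
  refine ⟨⟨?_, ?_⟩, proj⟩
  · intro c c' h
    funext j
    rw [← proj c j, ← proj c' j]
    exact congrArg (complexBetti.map (ι j).hom.hom.hom 1) h
  · intro x
    refine ⟨fun i => complexBetti.map (ι i).hom.hom.hom 1 x, ?_⟩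
    have hx : complexBetti.map (∑ i, π i ≫ ι i).hom.hom.hom 1 x = x := by
      rw [hsum]
      exact complexBetti_map_id_one_apply x
    conv_rhs => rw [← hx]
    rw [complexBetti_map_finsetSum_one]
    change _ = (∑ i, complexBetti.map (π i ≫ ι i).hom.hom.hom 1).hom x
    rw [ModuleCat.hom_sum, LinearMap.coe_sum, Finset.sum_apply]
    refine Finset.sum_congr rfl fun i _ => ?_
    exact complexBetti_map_map_one_apply (π i) (ι i) x
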